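import Mathlib
import Summits.Ventures.PercRepro.TriangleCapFourRowTwoCapThree
import Summits.Ventures.PercRepro.TriangleCapFourRowTwoLocus
import Summits.Ventures.PercRepro.TriangleCapDiamondExtremal

/-!
# PercRepro — THE NON-BIPARTITE SECOND-ORDER LOCUS OF THE CELL `(k, 4, 2)` FOR EVERY `k ≥ 10`: the cell `(10, 22)`
through the envelope (p3, gen 45; part 201d)

Part 201b proved the locus for `k ≥ 11`, part 201c the cap for every `k ≥ 10` with every degree `≥ 3`; the census
(kit j316659) says the `25,200 = 10 · C(9,4) · 20` non-`4`-bipartite second-best graphs of `(10, 22)` are exactly the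
hung `K_{4,5}`. Here: `four_two_del_two_ten` — at `k = 10` a vertex of degree `2` is deleted onto `(9, 20)`, where
every `K₄⁻`-free graph is `K_{4,5}` (`k4mFree_extremal_bipSub`); `four_two_del_three_strong` (`k ≥ 10`, every degree
`≤ k − 5`) — the degree-`3` deletion of part 201a′ with the neighbours at `≤ k − 6` in `D − z`; `four_two_cross_ten` —
a vertex of degree `≤ 1` at `k = 10` exceeds the envelope. Hence `four_two_nonbip_second_locus'` (`10 ≤ k`) and
`four_two_nonbip_second_best_maximisers'`: for EVERY `k ≥ 10` the non-`4`-bipartite second-best graphs of `(k, 4, 2)`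
are exactly the hung `K_{4,k−5}`. Axioms: standard.
-/

namespace PercRepro

namespace TriangleCap

namespace C047

open Finset

variable {V : Type*} [Fintype V] [DecidableEq V]

/-- The arithmetic of the strict degree-`3` deletion onto a non-`4`-bipartite `D − z` with the neighbours at
`≤ k − 6` (room `m′ − 17`, `k ≥ 10`). -/
theorem four_two_del_three_gap_strong_arith (k m m' S' T : ℕ) (hk : 10 ≤ k) (hm : m + 2 = 4 * (k - 4))
    (hm' : m' + 3 = m) (hS' : S' + (k - 1 - 2) + 2 * (k - 1 - 2 * 4 - 1) * (4 - 1) ≤ m' * (k - 1))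
    (hT : T ≤ 3 * (k - 6)) :
    S' + 2 * T + 3 + 3 * 3 + 2 * (k - 3) + 2 * (k - 9) + 2 ≤ m * k := by
  obtain ⟨t, rfl⟩ : ∃ t, k = t + 10 := ⟨k - 10, by omega⟩
  have hm1 : m = 4 * t + 22 := by omega
  have hm2 : m' = 4 * t + 19 := by omega
  subst hm1 hm2
  have e1 : t + 10 - 1 = t + 9 := by omega
  have e2 : t + 10 - 1 - 2 = t + 7 := by omega
  have e3 : t + 10 - 1 - 2 * 4 - 1 = t := by omega
  have e4 : t + 10 - 3 = t + 7 := by omega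
  have e5 : t + 10 - 9 = t + 1 := by omega
  have e6 : t + 10 - 6 = t + 4 := by omega
  rw [e3, e2, e1] at hS'
  rw [e6] at hT
  rw [e4, e5]
  nlinarith [hS', hT]

/-- The arithmetic of the strict degree-`3` deletion onto a `4`-bipartite `D − z` with one missing pair, `k ≥ 10`
(the `K₄⁻`-refined `T ≤ 2 (k − 5) + 3`). -/
theorem four_two_del_three_bip_strict_arith' (k m m' S' T : ℕ) (hk : 10 ≤ k) (hm : m + 2 = 4 * (k - 4))
    (hm' : m' + 3 = m) (hS' : S' + 1 * (k - 1 - 1 - 1) ≤ m' * (k - 1)) (hT : T ≤ 2 * (k - 1 - 4) + 3) :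
    S' + 2 * T + 3 + 3 * 3 + 2 * (k - 3) + 2 * (k - 9) + 2 ≤ m * k := by
  obtain ⟨t, rfl⟩ : ∃ t, k = t + 10 := ⟨k - 10, by omega⟩
  have hm1 : m = 4 * t + 22 := by omega
  have hm2 : m' = 4 * t + 19 := by omega
  subst hm1 hm2
  have e1 : t + 10 - 1 = t + 9 := by omega
  have e2 : t + 10 - 1 - 1 - 1 = t + 7 := by omega
  have e3 : t + 10 - 3 = t + 7 := by omega
  have e4 : t + 10 - 9 = t + 1 := by omega
  have e5 : t + 10 - 1 - 4 = t + 5 := by omega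
  rw [e2, e1] at hS'
  rw [e5] at hT
  rw [e3, e4]
  nlinarith [hS', hT]

/-- **A VERTEX OF DEGREE `3` ON THE CELL `(k, 4, 2)`, `10 ≤ k`, EVERY DEGREE `≤ k − 5`, IS STRICT:** `D` is `4`-bipartite
or `Σ_v d(v)² + 2 (k − 3) + 2 (k − 9) + 2 ≤ m k`. -/
theorem four_two_del_three_strong (D : SimpleGraph V) [DecidableRel D.Adj] (hK : K4mFree D)
    (hk : 10 ≤ Fintype.card V) (hm : D.edgeFinset.card + 2 = 4 * (Fintype.card V - 4))
    (hcap : ∀ v, deg D v + 5 ≤ Fintype.card V) (z : V) (hz : deg D z = 3) :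
    (∃ A : Finset V, A.card = 4 ∧ BipSub D A) ∨
      ∑ v, deg D v * deg D v + 2 * (Fintype.card V - 3) + 2 * (Fintype.card V - 9) + 2 ≤
        D.edgeFinset.card * Fintype.card V := by
  have hK' := k4mFree_del D hK z
  have hcard' := card_del z
  have hedges' := card_edges_del D z
  have hsq := sum_deg_sq_del D z
  rw [hz] at hedges' hsq
  obtain ⟨k, hk'⟩ : ∃ k, Fintype.card V = k := ⟨_, rfl⟩
  have hcardW' : Fintype.card {v : V // v ≠ z} = k - 1 := by omega
  obtain ⟨m, hmdef⟩ : ∃ m, D.edgeFinset.card = m := ⟨_, rfl⟩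
  obtain ⟨m', hm'def⟩ : ∃ m', (del D z).edgeFinset.card = m' := ⟨_, rfl⟩
  rw [hmdef] at hedges' hm
  rw [hm'def] at hedges'
  rw [hk'] at hm hk hcap
  have hm' : (del D z).edgeFinset.card + 1 = 4 * (Fintype.card {v : V // v ≠ z} - 4) := by
    rw [hm'def, hcardW']
    have e : 4 * (k - 4) = 4 * (k - 1 - 4) + 4 := by omega
    omega
  obtain ⟨T, hTdef⟩ : ∃ T, ∑ w : {v : V // v ≠ z}, (if D.Adj w.1 z then deg (del D z) w else 0) = T := ⟨_, rfl⟩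
  obtain ⟨S', hS'def⟩ : ∃ S', ∑ w : {v : V // v ≠ z}, deg (del D z) w * deg (del D z) w = S' := ⟨_, rfl⟩
  rw [hTdef, hS'def] at hsq
  rcases one_below_second_order_gen (del D z) hK' 4 (le_refl 4) (by omega) hm' with ⟨A', hA'card, hA'⟩ | hgap
  · by_cases hin : ∀ w : {v : V // v ≠ z}, D.Adj w.1 z → w ∈ A'
    · obtain ⟨B, hBcard, hB⟩ := bipSub_lift D z A' hA' hin
      exact Or.inl ⟨B, by rw [hBcard, hA'card], hB⟩
    · right
      push Not at hin
      obtain ⟨w₀, hw₀, hw₀A⟩ := hin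
      have hT := four_two_del_three_T D hK z A' hA' hA'card (by omega) hz w₀ hw₀ hw₀A
      rw [hTdef, hcardW'] at hT
      have hS' := sum_deg_sq_le_of_bipSub (del D z) A' hA' 4 1 hA'card hm' (by omega)
      rw [hS'def, hm'def, hcardW'] at hS'
      rw [hsq, hmdef, hk']
      exact four_two_del_three_bip_strict_arith' k m m' S' T hk hm hedges' hS' hT
  · right
    have hT := sum_del_nbhd_le D z (k - 6) (fun v => by have := hcap v; omega)
    rw [hTdef, hz] at hT
    rw [hS'def, hm'def, hcardW'] at hgap
    rw [hsq, hmdef, hk']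
    exact four_two_del_three_gap_strong_arith k m m' S' T hk hm hedges' hgap hT

/-- **A VERTEX OF DEGREE `2` ON THE CELL `(10, 22)`:** `D − z` is `K_{4,5}`; `D` is `4`-bipartite, a hung `K_{4,5}`, or
strictly below. -/
theorem four_two_del_two_ten (D : SimpleGraph V) [DecidableRel D.Adj] (hK : K4mFree D)
    (hk : Fintype.card V = 10) (hm : D.edgeFinset.card + 2 = 4 * (Fintype.card V - 4)) (z : V)
    (hz : deg D z = 2) :
    (∃ A : Finset V, A.card = 4 ∧ BipSub D A) ∨ HungK4 D ∨
      ∑ v, deg D v * deg D v + 2 * (Fintype.card V - 3) + 2 * (Fintype.card V - 9) + 2 ≤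
        D.edgeFinset.card * Fintype.card V := by
  have hK' := k4mFree_del D hK z
  have hcard' := card_del z
  have hedges' := card_edges_del D z
  have hsq := sum_deg_sq_del D z
  rw [hz] at hedges' hsq
  have hcardW' : Fintype.card {v : V // v ≠ z} = 9 := by omega
  rw [hk] at hm
  have hE' : (del D z).edgeFinset.card = 4 * (Fintype.card {v : V // v ≠ z} - 4) := by
    rw [hcardW']
    omega
  obtain ⟨A', hA'card, hA'⟩ := k4mFree_extremal_bipSub (del D z) hK' (by omega) (by rw [hcardW']; omega)
  rw [hcardW'] at hA'card
  norm_num at hA'card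
  by_cases hin : ∀ w : {v : V // v ≠ z}, D.Adj w.1 z → w ∈ A'
  · obtain ⟨B, hBcard, hB⟩ := bipSub_lift D z A' hA' hin
    exact Or.inl ⟨B, by rw [hBcard, hA'card], hB⟩
  push Not at hin
  obtain ⟨w₀, hw₀, hw₀A⟩ := hin
  by_cases hin2 : ∃ w : {v : V // v ≠ z}, D.Adj w.1 z ∧ w ∈ A'
  · obtain ⟨w, hw, hwA⟩ := hin2
    exact Or.inr (Or.inl ⟨z, A', hz, hA'card, hA', hE', w, w₀, hwA, hw₀A, hw, hw₀⟩)
  · right; right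
    push Not at hin2
    obtain ⟨T, hTdef⟩ : ∃ T, ∑ w : {v : V // v ≠ z}, (if D.Adj w.1 z then deg (del D z) w else 0) = T := ⟨_, rfl⟩
    obtain ⟨S', hS'def⟩ : ∃ S', ∑ w : {v : V // v ≠ z}, deg (del D z) w * deg (del D z) w = S' := ⟨_, rfl⟩
    rw [hTdef, hS'def] at hsq
    have hT : T ≤ 8 := by
      rw [← hTdef]
      have h1 : ∑ w : {v : V // v ≠ z}, (if D.Adj w.1 z then deg (del D z) w else 0) ≤
          ∑ w : {v : V // v ≠ z}, (if D.Adj w.1 z then 4 else 0) := by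
        apply sum_le_sum
        intro w _
        by_cases h : D.Adj w.1 z
        · simp only [h, if_true]
          have := deg_le_card_of_bipSub (del D z) A' hA' w (hin2 w h)
          rw [hA'card] at this
          exact this
        · simp only [h, if_false]
          exact le_refl 0
      rw [sum_del_nbhd_const D z 4, hz] at h1
      exact h1
    haveI : Nonempty {v : V // v ≠ z} := Fintype.card_pos_iff.mp (by omega)
    have hS' := sum_deg_sq_eq_of_bipSub_full (del D z) A' 4 hA'card hA' hE' inferInstance
    rw [hS'def, hE', hcardW'] at hS'
    rw [hsq, hk]
    omega

/-- **A VERTEX OF DEGREE `≤ 1` ON THE CELL `(10, 22)` IS IMPOSSIBLE:** `D − z` has `≥ 21 > 20` edges on `9` vertices. -/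
theorem four_two_cross_ten (D : SimpleGraph V) [DecidableRel D.Adj] (hK : K4mFree D)
    (hk : Fintype.card V = 10) (hm : D.edgeFinset.card + 2 = 4 * (Fintype.card V - 4)) (z : V)
    (hz : deg D z ≤ 1) : False := by
  have hK' := k4mFree_del D hK z
  have hcard' := card_del z
  have hedges' := card_edges_del D z
  have henv := four_mul_card_edges_le_sq (del D z) hK' (by omega)
  have hc : Fintype.card {v : V // v ≠ z} = 9 := by omega
  rw [hc] at henv
  rw [hk] at hm
  omega

/-- **THE NON-BIPARTITE SECOND-ORDER LOCUS OF THE CELL `(k, 4, 2)`, EVERY `k ≥ 10`:** a `K₄⁻`-free graph with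
`4 (k − 4) − 2` edges that is not `4`-bipartite and attains `Σ_v d(v)² + 2 (k − 3) + 2 (k − 9) = m k` is a hung
`K_{4,k−5}`. -/
theorem four_two_nonbip_second_locus' (D : SimpleGraph V) [DecidableRel D.Adj] (hK : K4mFree D)
    (hk : 10 ≤ Fintype.card V) (hm : D.edgeFinset.card + 2 = 4 * (Fintype.card V - 4))
    (hnb : ¬ ∃ A : Finset V, A.card = 4 ∧ BipSub D A)
    (heq : ∑ v, deg D v * deg D v + 2 * (Fintype.card V - 3) + 2 * (Fintype.card V - 9) =
      D.edgeFinset.card * Fintype.card V) :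
    HungK4 D := by
  rcases Nat.lt_or_ge (Fintype.card V) 11 with hk10 | hk11
  · have hk' : Fintype.card V = 10 := by omega
    have hcap : ∀ v, deg D v + 4 ≤ Fintype.card V := fun v =>
      deg_add_le_card_of_dense D hK 4 (by omega) (by omega)
        (cap_arith 4 (Fintype.card V) D.edgeFinset.card 2 (by omega) (by omega)
          (below_cap_arith 4 (Fintype.card V) D.edgeFinset.card 2 (by omega) hm)) v
    by_cases hsmall : ∃ z, deg D z ≤ 2
    · obtain ⟨z, hz⟩ := hsmall
      rcases Nat.lt_or_ge (deg D z) 2 with hz1 | hz2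
      · exact absurd (four_two_cross_ten D hK hk' hm z (by omega)) id
      · rcases four_two_del_two_ten D hK hk' hm z (by omega) with h | h | h
        · exact absurd h hnb
        · exact h
        · exfalso
          omega
    · push Not at hsmall
      exfalso
      by_cases hx : ∃ x, deg D x + 4 = Fintype.card V
      · obtain ⟨x, hx⟩ := hx
        rcases four_two_cap_strict_three D hK hk hm (fun v => by have := hsmall v; omega) x hx with h | h
        · exact hnb h
        · omega
      · push Not at hx
        have hcap' : ∀ v, deg D v + 5 ≤ Fintype.card V := fun v => by
          have h1 := hcap v
          have h2 := hx v
          omega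
        by_cases h3 : ∃ z, deg D z ≤ 3
        · obtain ⟨z, hz⟩ := h3
          rcases four_two_del_three_strong D hK hk hm hcap' z (by have := hsmall z; omega) with h | h
          · exact hnb h
          · omega
        · push Not at h3
          have := four_two_convex_strict D hk hm hcap' (fun v => by have := h3 v; omega)
          omega
  · exact four_two_nonbip_second_locus D hK hk11 hm hnb heq

/-- **THE NON-BIPARTITE SECOND-BEST GRAPHS OF THE CELL `(k, 4, 2)` FOR EVERY `k ≥ 10`, ON `Fin k`:** a
non-`4`-bipartite `K₄⁻`-free graph with `4 (k − 4) − 2` edges attains `Σ_v d(v)² + 2 (k − 3) + 2 (k − 9) = m k` iff it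
is a hung `K_{4,k−5}`. -/
theorem four_two_nonbip_second_best_maximisers' (k : ℕ) (hk : 10 ≤ k) (D : SimpleGraph (Fin k))
    [DecidableRel D.Adj] (hK : K4mFree D) (hm : D.edgeFinset.card + 2 = 4 * (k - 4))
    (hnb : ¬ ∃ A : Finset (Fin k), A.card = 4 ∧ BipSub D A) :
    ∑ v, deg D v * deg D v + 2 * (k - 3) + 2 * (k - 9) = D.edgeFinset.card * k ↔ HungK4 D := by
  have hcard : Fintype.card (Fin k) = k := Fintype.card_fin k
  constructor
  · intro heq
    exact four_two_nonbip_second_locus' D hK (by rw [hcard]; exact hk) (by rw [hcard]; exact hm) hnb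
      (by rw [hcard]; exact heq)
  · intro hH
    have := (hungK4_value D (by rw [hcard]; omega) hH).2.1
    rw [hcard] at this
    exact this

end C047

end TriangleCap

end PercRepro
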